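import Literature.MathematicalPhysics.QuantumFieldTheory.Balaban1983to89.B4GaussRep36
import Literature.MathematicalPhysics.QuantumFieldTheory.Balaban1983to89.B4Sect5Torus
import Literature.MathematicalPhysics.QuantumFieldTheory.Balaban1983to89.B4Ineq115Sect3Route

/-!
# B4, pp. 593–594: Proposition I.2.3 by the §5 route — *"From these properties it follows that Proposition I.2.3
is a consequence of the following Theorem"* — kernel-proved over the plain-matrix dictionary of `B4GaussRep36`, for
every gauge field and EVERY `Λ`, modulo the printed analytic inputs (5.3) and Corollary 2.3

T. Bałaban, *Regularity and decay of lattice Green's functions*, Commun. Math. Phys. **89** (1983) 571–597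
[Balaban1983RegularityDecay] (= B4), Sect. 5 opening, p. 593 [PDF 23] – p. 594 [PDF 24] (journal page = PDF page +
570; `lit read paper:balaban1983-cmp89-regularity-decay --pages 23-24`).  Unit lit-balaban-r01 gen 3 (reader/typer r01
of block B4, fold owner of row B4.Prop2.3[I]); statement-level skeleton of published theorems with citation tags;
proofs where landed; nothing here is a claim about the Yang–Mills mass gap.

## The printed passage (p. 593 [PDF 23] – p. 594 [PDF 24], verbatim from the ×2 renders
`run/shared/lean/pub/pub-balaban/b2b-balaban-ref1/pages/1983-cmp89-regularity-decay/…-p023-x2.png`, `…-p024-x2.png`)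

*"5. A General Theorem on Unit Lattice Operators. There is another way of proving Proposition I.2.3, relying on a
general theorem concerning inverses to some unit lattice operators. This theorem is interesting enough in itself to
devote a separate section to it. At first let us prove that the bounds (1.11)* [sic — the two-sided form bound (1.15)
of Proposition 2.3 of [1], p. 574] *are consequences of Proposition II.3.1′. The upper bound is quite elementary
because Δ^{(k)}(Ω,A) + aL^{−2}P(A) = a_kI − a_k²Q_k(A)G_k(Ω,A)Q_k^*(A) + aL^{−2}P(A) ≦ a_kI + aL^{−2}Q^*(A)Q(A) ≦
(a_k + aL^{−2})I = a(a_k/a_{k+1})I. (5.1) The operators are considered as defined on L²(Ω^{(k)}). To prove the lower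
bound we apply Proposition II.3.1′ to Δ^{(k)}(Ω,A): … (5.2) … thus we have ⟨φ, (Δ^{(k)}(Ω,A) + aL^{−2}P(A))φ⟩ ≧
γ₀′⟨φ,φ⟩ − O(e^{2−δ})⟨φ,φ⟩ ≧ γ₀″⟨φ,φ⟩. (5.3) for e sufficiently small and we get the lower bound. Finally Corollary
2.3 implies that the considered operator is short-ranged in the sense that for some δ₀ > 0 |(Δ^{(k)}(Ω,A) +
aL^{−2}P(A))(x,x′)| ≦ c₀e^{−δ₀|x−x′|}, x, x′ ∈ Ω^{(k)}, (5.4) and a change of the domain Ω implies a change of the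
operator which can be estimated in the following way |(Δ^{(k)}(Ω,A) − Δ^{(k)}(Ω₀,A))(x,x′)| ≦
c₀e^{−δ₀(|x−x′| + dist(x,Ω^{(k)c}) + dist(x′,Ω^{(k)c}))}, Ω ⊂ Ω₀, x, x′ ∈ Ω^{(k)}. (5.5) From these properties it
follows that Proposition I.2.3 is a consequence of the following Theorem."* (and p. 574 [PDF 4]: *"The fifth
section will be devoted to a general theorem concerning operators on the unit lattice Z^d. There we have abstracted
some basic features of our method and we have proven a theorem which, if applied to operators (1.14), gives another
proof of Proposition 2.3."*) — the Theorem ((5.6) ⇒ (5.7), (5.8), (5.10), p. 594) being KERNEL-PROVED in the tree: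
`B4Sect5Proof.sect5ThmUniform_holds` (ℤ^d, unit pv23-g3) and, over an ARBITRARY finite index set with a
pseudo-distance `ρ` of lattice-sum profile `K`, `B4Sect5Torus.sect5_uniform` (unit pv09-g4) with the explicit
constants `cSt K γ₀ c₀ δ₀`, `dSt K γ₀ c₀ δ₀` — the form used below.  The `γ₀` of the binder `hlow` below is the
`γ₀″` of (5.3) (= the `γ₀` of (5.6)).

## Dictionary (module `…B4GaussRep36`; nothing is re-declared, no definition is introduced)

`H` = the form matrix of `−Δ^{η,N}_{A,Ω} + m_k²` on the fine lattice `X`; `Qk : Matrix Y X ℝ` = `Q_k(A)` (1.4) on the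
unit lattice `Y = Ω^{(k)}` (sites × components); `gk H ak Qk = (H + a_kQ_kᵀQ_k)⁻¹ = G_k(Ω,A)` (1.6); `deltaK H ak Qk =
a_k1 − a_k²Q_kG_k(Ω,A)Q_kᵀ = Δ^{(k)}(Ω,A)` (1.14); `pOp w Q = wQᵀQ = P(A)`, `Q : Matrix Z Y ℝ` the next `L`-block
averaging, `ℓ = L^{−2}`.  The operator of (5.1)–(5.4) is `deltaK H ak Qk + (a*ℓ)•pOp w Q`; its `Λ`-block is
`cOpLam … Λ = (…).submatrix Subtype.val Subtype.val` and `cLam … Λ = (cOpLam … Λ)⁻¹ = C^{(k)}_Λ(Ω,A)` (1.13).  Hence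
`C^{(k)}_Λ(Ω,A)` IS, definitionally, the `C_Λ = A_Λ^{−1}` of the Sect. 5 Theorem for the compression along the injection
`Subtype.val : Λ → Y` — which is how `B4Sect5Torus.sect5_uniform` is typed.  A second region `Ω₀ ⊃ Ω` enters, as in
`B4Prop23Sect3Route` §4, through a second form matrix `H₀` on the same index sets (the dictionary user restricts the
operators of `Ω₀` to `Ω`, `Ω^{(k)}`: (5.5), (5.9), (5.10) compare operators on `L²(Ω^{(k)})`).

## What is kernel-checked here (theorems only; 0 sorry; no new notion, no named fact)

* §1 **(5.4) from Corollary 2.3** (`abs_kOp_apply_le`, `abs_kOp_apply_le_exp`): the (2.30)-shape bilinear decay of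
  `G_k(Ω,A)` — hypothesis `hG`, the PRINTED Corollary 2.3 for the one-scale propagator (no "slight changes" needed on
  this route) — together with the supports `S_y` and square norms `≤ c_k` of the rows `q_k(y)` of `Q_k(A)` gives
  `|(Δ^{(k)}(Ω,A) + aL^{−2}P(A))(y,y′)| ≤ a_k²·cκc_k·e^{−δ·dist(S_y,S_{y′})} + aL^{−2}|P(A;y,y′)| + a_kδ_{yy′}`, and with
  `|y−y′| ≤ dist(S_y,S_{y′}) + r`, `P(A;y,y′) ≠ 0 ⇒ |y−y′| ≤ r`, `|P| ≤ 1` the printed form with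
  `c₀ = (a_k²cκc_k + aL^{−2} + a_k)e^{δr}`, `δ₀ = δ`.
* §2 **(5.5) from the Theorem (1.11)–(1.12)** (`abs_deltaK_sub_apply_le`, `abs_deltaK_sub_apply_le_exp`): the
  three-distance bilinear decay of `δG_k(Ω,Ω₀,A) = G_k(Ω,A) − G_k(Ω₀,A)` (hypothesis `hGd`) gives the (5.5) = (5.9)-shape
  bound for `Δ^{(k)}(Ω,A) − Δ^{(k)}(Ω₀,A) = −a_k²Q_k·δG_k·Q_kᵀ`, `c₀ = a_k²cκc_k·e^{3δr}`.
* §3 symmetry of `Δ^{(k)}(Ω,A) + aL^{−2}P(A)` (`kOp_isSymm`), the packaging of (5.3) + (5.4) as condition (5.6)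
  (`hyp56_kOp`) and of (5.5) as condition (5.9) (`hyp59_deltaK_sub`), in the typing of `B4Sect5Torus`.
* §4 **"Proposition I.2.3 is a consequence of the following Theorem"** (`prop23_of_sect5`): on every finite index set
  `Y` with a pseudo-distance `ρ` of profile `K`, (5.6) for `Δ^{(k)}(Ω,A) + aL^{−2}P(A)` yields, for EVERY `Λ ⊆ Y`
  (the Sect. 5 Theorem has no "sum of big blocks" restriction), (1.16) `|C^{(k)}_Λ(Ω,A;y,y′)| ≤ c₁e^{−δ₁ρ(y,y′)}`,
  (1.17)–(1.18) `|C^{(k)}_Λ(y,y′) − C^{(k)}(y,y′)| ≤ c₁e^{−δ₁(ρ(y,y′) + dist(y,Λᶜ) + dist(y′,Λᶜ))}` (any admissible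
  boundary weight `β ≤ dist(·,Λᶜ)`), and — given (5.6) for the operator of `Ω₀` and (5.9) for the difference (5.5) —
  (1.19)–(1.20) `|C^{(k)}_Λ(Ω,A;y,y′) − C^{(k)}_Λ(Ω₀,A;y,y′)| ≤ c₁e^{−δ₁(ρ(y,y′) + ω(y) + ω(y′))}`, with the tree's
  explicit `c₁ = cSt K γ₀ c₀ δ₀`, `δ₁ = dSt K γ₀ c₀ δ₀`, *"functions of δ₀, γ₀, c₀"* (p. 597) and of the profile only;
  `C^{(k)}(Ω,A) = (Δ^{(k)}(Ω,A) + aL^{−2}P(A))^{−1} = C^{(k)}_{Ω^{(k)}}(Ω,A)` (`cLam_univ_apply`).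
* §5 the two combined (`prop23_116_118_of_cor23`): (1.16) and (1.18) for all `Λ` and all gauge fields from (5.3),
  Corollary 2.3 for `G_k(Ω,A)` and the structure of `Q_k(A)`, `P(A)`, with explicit constants.
* §6 (v1.1) **the two printed routes combined** (`prop23_116_118_of_cor23_rep36`): the lower bound (5.3) supplied not
  by Proposition II.3.1′ but by the §3 route's (1.15) (`B4Ineq115Sect3Route.form115_lower`: (3.6) at `Λ = Ω^{(k)}` and
  the `L²` bound `G^η_{k+1}(Ω,A) ≤ c′` give `γ₀ = (c′c_k′ + a_k⁻¹)⁻¹`, p. 589 *"(1.15) … simple consequences of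
  Corollary 2.3"*), so that (1.16) and (1.18) hold for EVERY `Λ` and every gauge field modulo Corollary 2.3-type
  bounds for the ONE-scale propagators `G_k(Ω,A)` (kernel decay (2.30)) and `G^η_{k+1}(Ω,A)` (`L²` bound) only.
* §7 (v1.2) **(1.19)–(1.20) assembled** (`prop23_120_of_cor23`, `prop23_120_of_cor23_rep36`): for two regions
  `Ω ⊂ Ω₀` — two form matrices `H`, `H₀` on the same index sets — the bound *"|δC^{(k)}_Λ(Ω,Ω₀,A;x,x′)| ≤
  c₀exp(−δ₀|x−x′| − δ₀dist(x,Ω^{(k)c}) − δ₀dist(x′,Ω^{(k)c}))"* for EVERY `Λ` and every gauge field, from (5.3) for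
  both operators (`hlow`, `hlow₀`; in the `_rep36` form: from (3.6), (1.8) and the `L²` bounds, as in §6), Corollary 2.3
  (2.30) for `G_k(Ω,A)` and `G_k(Ω₀,A)` (`hG`, `hG₀`) and the Theorem (1.11)–(1.12) for `δG_k(Ω,Ω₀,A)` (`hGd`), for
  every admissible boundary weight `ω` (`0 ≤ ω`, `ρ`-Lipschitz, `ω(y) ≤ dist(S_y, Ω^c) + r` — `dist(·,Ω^{(k)c})`), with
  ONE explicit constant `c₀ = (a_k²cκc_k + aL^{−2} + a_k)e^{3δr}` serving (5.6) for both operators and (5.9).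
(1.15): the upper bound (5.1) is `B4Ineq115Sect3Route.form115_upper` (`γ₁ = a_k + aL^{−2}`, from (1.8) alone); the
lower bound IS (5.3).  The §3 route of the same Proposition (pp. 588–589) is `B4Prop23Sect3Route` /
`B4Ineq115Sect3Route` / `B4Sect3BlockAveraging`.

## What is NOT proved here (explicit binders, exactly the printed inputs)

(5.3) — Proposition II.3.1′ applied to `Δ^{(k)}(Ω,A)`, followed by the Neumann-decoupling / constant-field /
gauging-away argument of p. 593 (binder `hlow`; row B4.Prop3.1'[II], proved in the tree at `A = 0` only:
`B4Prop31Zero`); Corollary 2.3 (2.30) for `G_k(Ω,A)` (binder `hG`) and the Theorem (1.11)–(1.12) for `δG_k(Ω,Ω₀,A)`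
(binder `hGd`) at a general gauge field (row B4.Thm@573, proved in the tree at `A = 0`); the lattice-sum profile of the
index set (binder `hSB`: for `Y = B4.Idx Ω N`, `Ω ⊂ ℤ^d` finite, it is `B4Sect5Proof.idxSum_le` with `K(t) =
N·latticeConst d t`; on a discrete torus `B4Sect5Torus.trho_sumBound`); `|P(A;y,y′)| ≤ 1` (binder `hP1`; for the
lattice block averaging it follows from `QQᵀ = w⁻¹1`, `B4GaussRep36.RowOrtho`, as in the block-averaging assembly of
the §3 route).
-/

namespace Literature.MathematicalPhysics.QuantumFieldTheory.Balaban1983to89.B4Prop23Sect5Route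

open Matrix Finset Real B4GaussRep36

variable {X Y Z : Type*}

/-! ## §0. Helpers (plain pairings of rows; the generic Corollary 2.3 ⇒ kernel step) -/

/-- `(TMTᵀ)(y,y′) = ⟨t_y, Mt_{y′}⟩`. [folklore] -/
private theorem mul_mul_transpose_apply [Fintype X] {Λ : Type*} (T : Matrix Λ X ℝ) (M : Matrix X X ℝ)
    (y y' : Λ) : (T * M * Tᵀ) y y' = (fun x => T y x) ⬝ᵥ (M *ᵥ fun x => T y' x) := by
  rw [Matrix.mul_assoc, Matrix.mul_apply]
  simp only [Matrix.mul_apply, Matrix.transpose_apply, Matrix.mulVec, dotProduct]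

/-- `nrm t·nrm t′ ≤ κβ` if `nrm² = κ(·,·)` and both plain square norms are `≤ β`. [folklore] -/
private theorem nrm_mul_nrm_le [Fintype X] {nrm : (X → ℝ) → ℝ} {κ β : ℝ}
    (hn2 : ∀ u, nrm u ^ 2 = κ * (u ⬝ᵥ u)) (hκ : 0 ≤ κ) {t t' : X → ℝ} (ht : t ⬝ᵥ t ≤ β)
    (ht' : t' ⬝ᵥ t' ≤ β) : nrm t * nrm t' ≤ κ * β := by
  have h1 : nrm t ^ 2 ≤ κ * β := by rw [hn2]; exact mul_le_mul_of_nonneg_left ht hκ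
  have h2 : nrm t' ^ 2 ≤ κ * β := by rw [hn2]; exact mul_le_mul_of_nonneg_left ht' hκ
  nlinarith [sq_nonneg (nrm t - nrm t')]

/-- The generic step *"Corollary 2.3 implies that the considered operator is short-ranged"*: a (2.30)-shape bilinear
bound for `M` on supported test functions and rows of `T` supported in `S_y` with square norms `≤ β` give
`|(TMTᵀ)(y,y′)| ≤ cκβ·e^{−E(S_y,S_{y′})}`. [cite: Balaban1983RegularityDecay, (5.4) p.593] -/
private theorem abs_tmt_apply_le [Fintype X] {Λ : Type*} (T : Matrix Λ X ℝ) (M : Matrix X X ℝ)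
    {nrm : (X → ℝ) → ℝ} {κ β c : ℝ} (S : Λ → Finset X) (E : Finset X → Finset X → ℝ)
    (hn2 : ∀ u, nrm u ^ 2 = κ * (u ⬝ᵥ u)) (hκ : 0 ≤ κ) (hc : 0 ≤ c)
    (hS : ∀ (y : Λ) (x : X), x ∉ S y → T y x = 0)
    (hT : ∀ y, (fun x => T y x) ⬝ᵥ (fun x => T y x) ≤ β)
    (hM : ∀ (g g' : X → ℝ) (U U' : Finset X), (∀ x ∉ U, g x = 0) → (∀ x ∉ U', g' x = 0) →
      |g ⬝ᵥ (M *ᵥ g')| ≤ c * nrm g * nrm g' * Real.exp (-(E U U')))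
    (y y' : Λ) : |(T * M * Tᵀ) y y'| ≤ c * (κ * β) * Real.exp (-(E (S y) (S y'))) := by
  rw [mul_mul_transpose_apply]
  refine (hM _ _ (S y) (S y') (hS y) (hS y')).trans ?_
  have h := nrm_mul_nrm_le hn2 hκ (hT y) (hT y')
  calc c * nrm (fun x => T y x) * nrm (fun x => T y' x) * Real.exp (-(E (S y) (S y')))
      = c * (nrm (fun x => T y x) * nrm (fun x => T y' x)) * Real.exp (-(E (S y) (S y'))) := by ring
    _ ≤ c * (κ * β) * Real.exp (-(E (S y) (S y'))) :=
        mul_le_mul_of_nonneg_right (mul_le_mul_of_nonneg_left h hc) (Real.exp_pos _).le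

/-! ## §1. (5.4): *"Corollary 2.3 implies that the considered operator is short-ranged"* -/

/-- The kernel of the operator of (5.1): `(Δ^{(k)}(Ω,A) + aL^{−2}P(A))(y,y′) = a_kδ_{yy′} − a_k²(Q_kG_k(Ω,A)Q_kᵀ)(y,y′)
+ aL^{−2}P(A;y,y′)` — *"Δ^{(k)}(Ω,A) + aL^{−2}P(A) = a_kI − a_k²Q_k(A)G_k(Ω,A)Q_k^*(A) + aL^{−2}P(A)"* (5.1).
[cite: Balaban1983RegularityDecay, (5.1) p.593] -/
theorem kOp_apply [Fintype X] [Fintype Y] [Fintype Z] [DecidableEq X] [DecidableEq Y] (H : Matrix X X ℝ)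
    (ak : ℝ) (Qk : Matrix Y X ℝ) (a ℓ w : ℝ) (Q : Matrix Z Y ℝ) (y y' : Y) :
    (deltaK H ak Qk + (a * ℓ) • pOp w Q) y y' =
      (if y = y' then ak else 0) - ak ^ 2 * (Qk * gk H ak Qk * Qkᵀ) y y' + a * ℓ * pOp w Q y y' := by
  simp only [deltaK, Matrix.add_apply, Matrix.sub_apply, Matrix.smul_apply, Matrix.one_apply, smul_eq_mul,
    mul_ite, mul_one, mul_zero]

/-- **(5.4), support form, from Corollary 2.3** — *"Finally Corollary 2.3 implies that the considered operator is
short-ranged in the sense that for some δ₀ > 0 |(Δ^{(k)}(Ω,A) + aL^{−2}P(A))(x,x′)| ≤ c₀e^{−δ₀|x−x′|} (5.4)"* (p. 593):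
given the Corollary 2.3 (2.30)-shape bilinear decay of `G_k(Ω,A)` with constants `(c, δ)` (`hG`, the printed input),
rows `q_k(y)` of `Q_k(A)` supported in `S_y` (`hS`) with plain square norms `≤ c_k` (`hT`; *"The L²-norms of the
functions q_k(y) … are equal to 1"*, p. 588) and a weighted norm `‖u‖² = κ(u·u)`:
`|(Δ^{(k)}(Ω,A) + aL^{−2}P(A))(y,y′)| ≤ a_k²cκc_k·e^{−δ·dist(S_y,S_{y′})} + aL^{−2}|P(A;y,y′)| + a_kδ_{yy′}`.
[cite: Balaban1983RegularityDecay, (5.4) p.593, (5.1) p.593] -/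
theorem abs_kOp_apply_le [Fintype X] [Fintype Y] [Fintype Z] [DecidableEq X] [DecidableEq Y]
    {H : Matrix X X ℝ} {ak : ℝ} {Qk : Matrix Y X ℝ} {a ℓ w : ℝ} {Q : Matrix Z Y ℝ}
    {nrm : (X → ℝ) → ℝ} {sdist : Finset X → Finset X → ℝ} {κ ck c δ : ℝ} (S : Y → Finset X)
    (hS : ∀ (y : Y) (x : X), x ∉ S y → Qk y x = 0)
    (hT : ∀ y : Y, (fun x => Qk y x) ⬝ᵥ (fun x => Qk y x) ≤ ck)
    (hn2 : ∀ u, nrm u ^ 2 = κ * (u ⬝ᵥ u)) (hκ : 0 ≤ κ) (hc : 0 ≤ c) (hak : 0 ≤ ak) (haℓ : 0 ≤ a * ℓ)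
    (hG : ∀ (g g' : X → ℝ) (U U' : Finset X), (∀ x ∉ U, g x = 0) → (∀ x ∉ U', g' x = 0) →
      |g ⬝ᵥ (gk H ak Qk *ᵥ g')| ≤ c * nrm g * nrm g' * Real.exp (-(δ * sdist U U')))
    (y y' : Y) :
    |(deltaK H ak Qk + (a * ℓ) • pOp w Q) y y'| ≤
      ak ^ 2 * (c * (κ * ck)) * Real.exp (-(δ * sdist (S y) (S y'))) + a * ℓ * |pOp w Q y y'| +
        (if y = y' then ak else 0) := by
  rw [kOp_apply]
  set M : ℝ := (Qk * gk H ak Qk * Qkᵀ) y y' with hMdef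
  set i : ℝ := (if y = y' then ak else (0 : ℝ)) with hi
  have hM : |M| ≤ c * (κ * ck) * Real.exp (-(δ * sdist (S y) (S y'))) :=
    abs_tmt_apply_le Qk (gk H ak Qk) S (fun U U' => δ * sdist U U') hn2 hκ hc hS hT hG y y'
  have hi0 : 0 ≤ i := by
    rw [hi]; split_ifs
    · exact hak
    · exact le_rfl
  have h1 : |i - ak ^ 2 * M + a * ℓ * pOp w Q y y'| ≤ |i| + |-(ak ^ 2 * M)| + |a * ℓ * pOp w Q y y'| := by
    rw [sub_eq_add_neg]; exact abs_add_three _ _ _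
  have h2 : |-(ak ^ 2 * M)| = ak ^ 2 * |M| := by rw [abs_neg, abs_mul, abs_of_nonneg (sq_nonneg ak)]
  have h3 : |a * ℓ * pOp w Q y y'| = a * ℓ * |pOp w Q y y'| := by rw [abs_mul, abs_of_nonneg haℓ]
  rw [abs_of_nonneg hi0, h2, h3] at h1
  have h4 : ak ^ 2 * |M| ≤ ak ^ 2 * (c * (κ * ck) * Real.exp (-(δ * sdist (S y) (S y')))) :=
    mul_le_mul_of_nonneg_left hM (sq_nonneg ak)
  linarith

/-- **(5.4) AS PRINTED (point form, explicit constant)**: if the unit-lattice (pseudo-)distance is dominated by the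
support distance up to the block size `r` — `ρ(y,y′) ≤ dist(S_y,S_{y′}) + r`, `P(A;y,y′) ≠ 0 ⇒ ρ(y,y′) ≤ r` (one
`L`-block), `ρ(y,y) ≤ r` — and `|P(A;y,y′)| ≤ 1`, then *"|(Δ^{(k)}(Ω,A) + aL^{−2}P(A))(x,x′)| ≤ c₀e^{−δ₀|x−x′|} (5.4)"*
with `c₀ = (a_k²cκc_k + aL^{−2} + a_k)e^{δr}`, `δ₀ = δ`. [cite: Balaban1983RegularityDecay, (5.4) p.593] -/
theorem abs_kOp_apply_le_exp [Fintype X] [Fintype Y] [Fintype Z] [DecidableEq X] [DecidableEq Y]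
    {H : Matrix X X ℝ} {ak : ℝ} {Qk : Matrix Y X ℝ} {a ℓ w : ℝ} {Q : Matrix Z Y ℝ}
    {nrm : (X → ℝ) → ℝ} {sdist : Finset X → Finset X → ℝ} {κ ck c δ : ℝ} (S : Y → Finset X)
    (hS : ∀ (y : Y) (x : X), x ∉ S y → Qk y x = 0)
    (hT : ∀ y : Y, (fun x => Qk y x) ⬝ᵥ (fun x => Qk y x) ≤ ck)
    (hn2 : ∀ u, nrm u ^ 2 = κ * (u ⬝ᵥ u)) (hκ : 0 ≤ κ) (hc : 0 ≤ c) (hck : 0 ≤ ck) (hak : 0 ≤ ak)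
    (haℓ : 0 ≤ a * ℓ)
    (hG : ∀ (g g' : X → ℝ) (U U' : Finset X), (∀ x ∉ U, g x = 0) → (∀ x ∉ U', g' x = 0) →
      |g ⬝ᵥ (gk H ak Qk *ᵥ g')| ≤ c * nrm g * nrm g' * Real.exp (-(δ * sdist U U')))
    {ρ : Y → Y → ℝ} {r : ℝ} (hδ : 0 ≤ δ) (hρS : ∀ y y', ρ y y' ≤ sdist (S y) (S y') + r)
    (hρP : ∀ y y', pOp w Q y y' ≠ 0 → ρ y y' ≤ r) (hρ0 : ∀ y, ρ y y ≤ r) (hP1 : ∀ y y', |pOp w Q y y'| ≤ 1)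
    (y y' : Y) :
    |(deltaK H ak Qk + (a * ℓ) • pOp w Q) y y'| ≤
      (ak ^ 2 * (c * (κ * ck)) + a * ℓ + ak) * Real.exp (δ * r) * Real.exp (-(δ * ρ y y')) := by
  have h := abs_kOp_apply_le S hS hT hn2 hκ hc hak haℓ hG y y' (w := w) (Q := Q)
  set E : ℝ := Real.exp (δ * r) * Real.exp (-(δ * ρ y y')) with hE
  have hE' : E = Real.exp (δ * r - δ * ρ y y') := by rw [hE, ← Real.exp_add, sub_eq_add_neg]
  have hEpos : 0 < E := by rw [hE']; exact Real.exp_pos _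
  have h1 : Real.exp (-(δ * sdist (S y) (S y'))) ≤ E := by
    rw [hE', Real.exp_le_exp]
    nlinarith [mul_le_mul_of_nonneg_left (hρS y y') hδ]
  have h2 : |pOp w Q y y'| ≤ E := by
    by_cases hP : pOp w Q y y' = 0
    · rw [hP, abs_zero]; exact hEpos.le
    · refine (hP1 y y').trans ?_
      rw [hE', Real.one_le_exp_iff]
      nlinarith [mul_le_mul_of_nonneg_left (hρP y y' hP) hδ]
  have h3 : (if y = y' then ak else (0 : ℝ)) ≤ ak * E := by
    split_ifs with hyy
    · subst hyy
      have : (1 : ℝ) ≤ E := by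
        rw [hE', Real.one_le_exp_iff]
        nlinarith [mul_le_mul_of_nonneg_left (hρ0 y) hδ]
      nlinarith
    · exact mul_nonneg hak hEpos.le
  have hcoef1 : 0 ≤ ak ^ 2 * (c * (κ * ck)) := mul_nonneg (sq_nonneg _) (mul_nonneg hc (mul_nonneg hκ hck))
  have e : (ak ^ 2 * (c * (κ * ck)) + a * ℓ + ak) * Real.exp (δ * r) * Real.exp (-(δ * ρ y y')) =
      ak ^ 2 * (c * (κ * ck)) * E + a * ℓ * E + ak * E := by
    rw [hE]; ring
  rw [e]
  nlinarith [mul_le_mul_of_nonneg_left h1 hcoef1, mul_le_mul_of_nonneg_left h2 haℓ, h3, h]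

/-! ## §2. (5.5): *"a change of the domain Ω implies a change of the operator"* -/

/-- `Δ^{(k)}(Ω,A) − Δ^{(k)}(Ω₀,A) = −a_k²Q_k(G_k(Ω,A) − G_k(Ω₀,A))Q_kᵀ` entrywise (from (1.14) = (5.1) for both
regions, the operators of `Ω₀` restricted to `Ω`, `Ω^{(k)}`). [cite: Balaban1983RegularityDecay, (5.5) p.594, (1.14) p.573] -/
theorem deltaK_sub_apply [Fintype X] [Fintype Y] [DecidableEq X] [DecidableEq Y] (H H₀ : Matrix X X ℝ)
    (ak : ℝ) (Qk : Matrix Y X ℝ) (y y' : Y) :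
    (deltaK H ak Qk - deltaK H₀ ak Qk) y y' = -(ak ^ 2 * (Qk * (gk H ak Qk - gk H₀ ak Qk) * Qkᵀ) y y') := by
  have e : Qk * (gk H ak Qk - gk H₀ ak Qk) * Qkᵀ = Qk * gk H ak Qk * Qkᵀ - Qk * gk H₀ ak Qk * Qkᵀ := by
    rw [Matrix.mul_sub, Matrix.sub_mul]
  rw [e]
  simp only [deltaK, Matrix.sub_apply, Matrix.smul_apply, smul_eq_mul]
  ring

/-- **(5.5), support form, from the Theorem (1.11)–(1.12)** — *"a change of the domain Ω implies a change of the
operator which can be estimated in the following way |(Δ^{(k)}(Ω,A) − Δ^{(k)}(Ω₀,A))(x,x′)| ≤ c₀e^{−δ₀(|x−x′| +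
dist(x,Ω^{(k)c}) + dist(x′,Ω^{(k)c}))} (5.5)"* (p. 594): given the three-distance bilinear decay of `δG_k(Ω,Ω₀,A) =
G_k(Ω,A) − G_k(Ω₀,A)` ((1.11)–(1.12)/(2.31)-shape, `hGd`, the printed input; `sdc U` = the distance of `U` to the
complement region) and the rows of `Q_k(A)` as in §1:
`|(Δ^{(k)}(Ω,A) − Δ^{(k)}(Ω₀,A))(y,y′)| ≤ a_k²cκc_k·e^{−δ(dist(S_y,S_{y′}) + sdc S_y + sdc S_{y′})}`.
[cite: Balaban1983RegularityDecay, (5.5) p.594, (1.11)–(1.12) p.573] -/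
theorem abs_deltaK_sub_apply_le [Fintype X] [Fintype Y] [DecidableEq X] [DecidableEq Y]
    {H H₀ : Matrix X X ℝ} {ak : ℝ} {Qk : Matrix Y X ℝ}
    {nrm : (X → ℝ) → ℝ} {sdist : Finset X → Finset X → ℝ} {sdc : Finset X → ℝ} {κ ck c δ : ℝ}
    (S : Y → Finset X) (hS : ∀ (y : Y) (x : X), x ∉ S y → Qk y x = 0)
    (hT : ∀ y : Y, (fun x => Qk y x) ⬝ᵥ (fun x => Qk y x) ≤ ck)
    (hn2 : ∀ u, nrm u ^ 2 = κ * (u ⬝ᵥ u)) (hκ : 0 ≤ κ) (hc : 0 ≤ c)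
    (hGd : ∀ (g g' : X → ℝ) (U U' : Finset X), (∀ x ∉ U, g x = 0) → (∀ x ∉ U', g' x = 0) →
      |g ⬝ᵥ ((gk H ak Qk - gk H₀ ak Qk) *ᵥ g')| ≤
        c * nrm g * nrm g' * Real.exp (-(δ * (sdist U U' + sdc U + sdc U'))))
    (y y' : Y) :
    |(deltaK H ak Qk - deltaK H₀ ak Qk) y y'| ≤
      ak ^ 2 * (c * (κ * ck)) * Real.exp (-(δ * (sdist (S y) (S y') + sdc (S y) + sdc (S y')))) := by
  rw [deltaK_sub_apply, abs_neg, abs_mul, abs_of_nonneg (sq_nonneg ak), mul_assoc]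
  exact mul_le_mul_of_nonneg_left
    (abs_tmt_apply_le Qk (gk H ak Qk - gk H₀ ak Qk) S (fun U U' => δ * (sdist U U' + sdc U + sdc U'))
      hn2 hκ hc hS hT hGd y y') (sq_nonneg ak)

/-- **(5.5) AS PRINTED (point form, explicit constant)**: with `ρ(y,y′) ≤ dist(S_y,S_{y′}) + r` and a boundary weight
`ω(y) ≤ sdc S_y + r` (`ω` = `dist(y, Ω^{(k)c})`, blocks of size `r`):  `|(Δ^{(k)}(Ω,A) − Δ^{(k)}(Ω₀,A))(y,y′)| ≤
a_k²cκc_k e^{3δr}·e^{−δ(ρ(y,y′) + ω(y) + ω(y′))}` — the shape of condition (5.9). [cite: Balaban1983RegularityDecay, (5.5) p.594, (5.9) p.594] -/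
theorem abs_deltaK_sub_apply_le_exp [Fintype X] [Fintype Y] [DecidableEq X] [DecidableEq Y]
    {H H₀ : Matrix X X ℝ} {ak : ℝ} {Qk : Matrix Y X ℝ}
    {nrm : (X → ℝ) → ℝ} {sdist : Finset X → Finset X → ℝ} {sdc : Finset X → ℝ} {κ ck c δ : ℝ}
    (S : Y → Finset X) (hS : ∀ (y : Y) (x : X), x ∉ S y → Qk y x = 0)
    (hT : ∀ y : Y, (fun x => Qk y x) ⬝ᵥ (fun x => Qk y x) ≤ ck)
    (hn2 : ∀ u, nrm u ^ 2 = κ * (u ⬝ᵥ u)) (hκ : 0 ≤ κ) (hc : 0 ≤ c) (hck : 0 ≤ ck)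
    (hGd : ∀ (g g' : X → ℝ) (U U' : Finset X), (∀ x ∉ U, g x = 0) → (∀ x ∉ U', g' x = 0) →
      |g ⬝ᵥ ((gk H ak Qk - gk H₀ ak Qk) *ᵥ g')| ≤
        c * nrm g * nrm g' * Real.exp (-(δ * (sdist U U' + sdc U + sdc U'))))
    {ρ : Y → Y → ℝ} {ω : Y → ℝ} {r : ℝ} (hδ : 0 ≤ δ) (hρS : ∀ y y', ρ y y' ≤ sdist (S y) (S y') + r)
    (hωS : ∀ y, ω y ≤ sdc (S y) + r) (y y' : Y) :
    |(deltaK H ak Qk - deltaK H₀ ak Qk) y y'| ≤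
      ak ^ 2 * (c * (κ * ck)) * Real.exp (3 * (δ * r)) * Real.exp (-(δ * (ρ y y' + ω y + ω y'))) := by
  refine (abs_deltaK_sub_apply_le S hS hT hn2 hκ hc hGd y y').trans ?_
  have hcoef : 0 ≤ ak ^ 2 * (c * (κ * ck)) := mul_nonneg (sq_nonneg _) (mul_nonneg hc (mul_nonneg hκ hck))
  rw [mul_assoc (ak ^ 2 * (c * (κ * ck))), ← Real.exp_add]
  refine mul_le_mul_of_nonneg_left ?_ hcoef
  rw [Real.exp_le_exp]
  have h1 := mul_le_mul_of_nonneg_left (hρS y y') hδ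
  have h2 := mul_le_mul_of_nonneg_left (hωS y) hδ
  have h3 := mul_le_mul_of_nonneg_left (hωS y') hδ
  nlinarith

/-! ## §3. Symmetry, and the packaging of (5.3)–(5.5) as the conditions (5.6), (5.9) of the Theorem -/

/-- The form `−Δ^{η,N}_{A,Ω} + m_k² + a_kP_k(A)` of (1.6), `H + a_kQ_kᵀQ_k`, is symmetric when `H` is (a
positive self-adjoint operator, (1.8)). [cite: Balaban1983RegularityDecay, (1.6)–(1.8) pp.572–573] -/
theorem kForm_isSymm [Fintype Y] {H : Matrix X X ℝ} (hH : H.IsSymm) (ak : ℝ) (Qk : Matrix Y X ℝ) :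
    (kForm H ak Qk).IsSymm := by
  have h2 : (Qkᵀ * Qk).IsSymm := by
    unfold Matrix.IsSymm
    rw [Matrix.transpose_mul, Matrix.transpose_transpose]
  exact hH.add (h2.smul ak)

/-- `G_k(Ω,A) = (−Δ^{η,N}_{A,Ω} + m_k² + a_kP_k(A))^{−1}` (1.6) is symmetric when `H` is. [cite: Balaban1983RegularityDecay, (1.6)–(1.8) pp.572–573] -/
theorem gk_isSymm [Fintype X] [Fintype Y] [DecidableEq X] {H : Matrix X X ℝ} (hH : H.IsSymm) (ak : ℝ)
    (Qk : Matrix Y X ℝ) : (gk H ak Qk).IsSymm :=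
  (kForm_isSymm hH ak Qk).inv

/-- `Δ^{(k)}(Ω,A)` (1.14) is symmetric when `H` is. [cite: Balaban1983RegularityDecay, (1.14) p.573] -/
theorem deltaK_isSymm [Fintype X] [Fintype Y] [DecidableEq X] [DecidableEq Y] {H : Matrix X X ℝ}
    (hH : H.IsSymm) (ak : ℝ) (Qk : Matrix Y X ℝ) : (deltaK H ak Qk).IsSymm := by
  have h3 : (Qk * gk H ak Qk * Qkᵀ).IsSymm := by
    unfold Matrix.IsSymm
    rw [Matrix.transpose_mul, Matrix.transpose_mul, Matrix.transpose_transpose, (gk_isSymm hH ak Qk).eq,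
      Matrix.mul_assoc]
  exact (Matrix.isSymm_one.smul ak).sub (h3.smul (ak ^ 2))

/-- `P(A) = Q^*(A)Q(A)` ((5.1): *"aL^{−2}P(A) … ≦ … aL^{−2}Q^*(A)Q(A)"*), `wQᵀQ` in the dictionary, is symmetric.
[cite: Balaban1983RegularityDecay, (5.1) p.593] -/
theorem pOp_isSymm [Fintype Z] (w : ℝ) (Q : Matrix Z Y ℝ) : (pOp w Q).IsSymm := by
  have h2 : (Qᵀ * Q).IsSymm := by
    unfold Matrix.IsSymm
    rw [Matrix.transpose_mul, Matrix.transpose_transpose]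
  exact h2.smul w

/-- *"let A be a symmetric operator"* (p. 594): `Δ^{(k)}(Ω,A) + aL^{−2}P(A)` is symmetric when `H` is.
[cite: Balaban1983RegularityDecay, Sect. 5 Theorem p.594, (5.1) p.593] -/
theorem kOp_isSymm [Fintype X] [Fintype Y] [Fintype Z] [DecidableEq X] [DecidableEq Y] {H : Matrix X X ℝ}
    (hH : H.IsSymm) (ak : ℝ) (Qk : Matrix Y X ℝ) (a ℓ w : ℝ) (Q : Matrix Z Y ℝ) :
    (deltaK H ak Qk + (a * ℓ) • pOp w Q).IsSymm :=
  (deltaK_isSymm hH ak Qk).add ((pOp_isSymm w Q).smul (a * ℓ))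

/-- **(5.3) + (5.4) = condition (5.6)** for `Δ^{(k)}(Ω,A) + aL^{−2}P(A)`: symmetry, the lower bound *"⟨φ, (Δ^{(k)}(Ω,A)
+ aL^{−2}P(A))φ⟩ ≧ … ≧ γ₀″⟨φ,φ⟩. (5.3)"* (hypothesis `hlow` — from Proposition II.3.1′, the printed input) and the
kernel bound (5.4) (`hdec`, e.g. `abs_kOp_apply_le_exp`), in the typing `B4Sect5Torus.Hyp56` of the tree's Sect. 5
Theorem. [cite: Balaban1983RegularityDecay, (5.3)–(5.4) p.593, (5.6) p.594] -/
theorem hyp56_kOp [Fintype X] [Fintype Y] [Fintype Z] [DecidableEq X] [DecidableEq Y] {H : Matrix X X ℝ}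
    {ak : ℝ} {Qk : Matrix Y X ℝ} {a ℓ w : ℝ} {Q : Matrix Z Y ℝ} {ρ : Y → Y → ℝ} {γ₀ c₀ δ₀ : ℝ}
    (hH : H.IsSymm)
    (hlow : ∀ v : Y → ℝ, γ₀ * (v ⬝ᵥ v) ≤ v ⬝ᵥ ((deltaK H ak Qk + (a * ℓ) • pOp w Q) *ᵥ v))
    (hdec : ∀ y y', |(deltaK H ak Qk + (a * ℓ) • pOp w Q) y y'| ≤ c₀ * Real.exp (-(δ₀ * ρ y y'))) :
    B4Sect5Torus.Hyp56 ρ (deltaK H ak Qk + (a * ℓ) • pOp w Q) γ₀ c₀ δ₀ := by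
  refine ⟨kOp_isSymm hH ak Qk a ℓ w Q, fun v => ?_, hdec⟩
  have h := hlow v
  have e1 : v ⬝ᵥ v = ∑ p, v p ^ 2 := by simp only [dotProduct, pow_two]
  have e2 : v ⬝ᵥ ((deltaK H ak Qk + (a * ℓ) • pOp w Q) *ᵥ v) =
      ∑ p, v p * (deltaK H ak Qk + (a * ℓ) • pOp w Q).mulVec v p := rfl
  rw [e1, e2] at h
  exact h

/-- **(5.5) = condition (5.9)** for `B = Δ^{(k)}(Ω₀,A) − Δ^{(k)}(Ω,A)` (the perturbation taking the operator of `Ω` to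
that of `Ω₀` on `L²(Ω^{(k)})`; `P(A)` cancels): a pointwise bound of the printed shape (e.g.
`abs_deltaK_sub_apply_le_exp`) is `B4Sect5Torus.Hyp59 ρ ω B c₀ δ₀`. [cite: Balaban1983RegularityDecay, (5.5) p.594, (5.9) p.594] -/
theorem hyp59_deltaK_sub [Fintype X] [Fintype Y] [DecidableEq X] [DecidableEq Y] {H H₀ : Matrix X X ℝ}
    {ak : ℝ} {Qk : Matrix Y X ℝ} {ρ : Y → Y → ℝ} {ω : Y → ℝ} {c₀ δ₀ : ℝ}
    (h55 : ∀ y y', |(deltaK H ak Qk - deltaK H₀ ak Qk) y y'| ≤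
      c₀ * Real.exp (-(δ₀ * (ρ y y' + ω y + ω y')))) :
    B4Sect5Torus.Hyp59 ρ ω (deltaK H₀ ak Qk - deltaK H ak Qk) c₀ δ₀ := by
  intro y y'
  have e : (deltaK H₀ ak Qk - deltaK H ak Qk) y y' = -((deltaK H ak Qk - deltaK H₀ ak Qk) y y') := by
    simp only [Matrix.sub_apply]; ring
  rw [e, abs_neg]
  exact h55 y y'

/-! ## §4. *"From these properties it follows that Proposition I.2.3 is a consequence of the following Theorem"* -/

/-- `C^{(k)}(Ω,A) = (Δ^{(k)}(Ω,A) + aL^{−2}P(A))^{−1}` is `C^{(k)}_{Ω^{(k)}}(Ω,A)`, the case `Λ = Ω^{(k)}` of (1.13) (the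
`C_Ω = A^{−1}` of (5.8)). [cite: Balaban1983RegularityDecay, (1.13) p.573, (1.17) p.574] -/
theorem cLam_univ_apply [Fintype X] [Fintype Y] [Fintype Z] [DecidableEq X] [DecidableEq Y] (H : Matrix X X ℝ)
    (ak : ℝ) (Qk : Matrix Y X ℝ) (a ℓ w : ℝ) (Q : Matrix Z Y ℝ) (p q : (Finset.univ : Finset Y)) :
    cLam H ak Qk a ℓ w Q Finset.univ p q = (deltaK H ak Qk + (a * ℓ) • pOp w Q)⁻¹ p q := by
  let eU : {y : Y // y ∈ (Finset.univ : Finset Y)} ≃ Y :=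
    Equiv.subtypeUnivEquiv (fun y => Finset.mem_univ y)
  unfold cLam cOpLam
  show ((deltaK H ak Qk + (a * ℓ) • pOp w Q).submatrix eU eU)⁻¹ p q = _
  rw [Matrix.inv_submatrix_equiv]
  rfl

/-- **Proposition I.2.3 from the Sect. 5 Theorem** (p. 594: *"From these properties it follows that Proposition I.2.3
is a consequence of the following Theorem"*), over any finite unit-lattice index set `Y` with a pseudo-distance `ρ`
whose exponential sums have profile `K`: if `Δ^{(k)}(Ω,A) + aL^{−2}P(A)` satisfies (5.6) with `(γ₀, c₀, δ₀)` then,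
with the tree's constants `c₁ = cSt K γ₀ c₀ δ₀`, `δ₁ = dSt K γ₀ c₀ δ₀` (functions of `γ₀, c₀, δ₀` and `K` only) and
for EVERY `Λ ⊆ Y`:
(1.16) *"|C^{(k)}_Λ(Ω,A;x,x′)| ≤ c₀exp(−δ₀|x−x′|), x, x′ ∈ Λ"*;
(1.17)–(1.18) *"for δC^{(k)}_Λ(Ω,A) = C^{(k)}_Λ(Ω,A) − C^{(k)}(Ω,A) we have |δC^{(k)}_Λ(Ω,A;x,x′)| ≤ c₀exp(−δ₀|x−x′| −
δ₀dist(x,Λᶜ) − δ₀dist(x′,Λᶜ))"* (for every boundary weight `β ≥ 0` with `β(y) ≤ ρ(y,z)`, `z ∉ Λ`, e.g. `dist(·,Λᶜ)`);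
(1.19)–(1.20) *"for Λ ⊂ Ω^{(k)} ⊂ Ω₀^{(k)} and δC^{(k)}_Λ(Ω,Ω₀,A) = C^{(k)}_Λ(Ω,A) − C^{(k)}_Λ(Ω₀,A), |δC^{(k)}_Λ(Ω,Ω₀,A;
x,x′)| ≤ c₀exp(−δ₀|x−x′| − δ₀dist(x,Ω^{(k)c}) − δ₀dist(x′,Ω^{(k)c}))"* — given (5.6) for the operator of `Ω₀` (form
matrix `H₀`) and (5.9) for the difference (5.5), for every `ρ`-Lipschitz boundary weight `ω ≥ 0` (`dist(·,Ω^{(k)c})`).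
The Theorem itself is the tree's kernel proof `B4Sect5Torus.sect5_uniform`, applied to the compression along
`Subtype.val : Λ → Y`, which is `cOpLam`/`cLam` by definition. [cite: Balaban1983RegularityDecay, Prop. 2.3 of [1] (1.16)–(1.20) p.574, Sect. 5 Theorem p.594] -/
theorem prop23_of_sect5 [Fintype X] [Fintype Y] [Fintype Z] [DecidableEq X] [DecidableEq Y] {K : ℝ → ℝ}
    (hK : ∀ t, 0 < t → 0 ≤ K t) {γ₀ c₀ δ₀ : ℝ} (hγ : 0 < γ₀) (hc : 0 < c₀) (hδ : 0 < δ₀)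
    {ρ : Y → Y → ℝ} (hρ : B4Sect5Torus.IsPseudoDist ρ) (hSB : B4Sect5Torus.SumBound ρ K)
    {H : Matrix X X ℝ} {ak : ℝ} {Qk : Matrix Y X ℝ} {a ℓ w : ℝ} {Q : Matrix Z Y ℝ}
    (h56 : B4Sect5Torus.Hyp56 ρ (deltaK H ak Qk + (a * ℓ) • pOp w Q) γ₀ c₀ δ₀) (Λ : Finset Y) :
    (∀ y y' : Λ, |cLam H ak Qk a ℓ w Q Λ y y'| ≤
        B4Sect5Torus.cSt K γ₀ c₀ δ₀ * Real.exp (-(B4Sect5Torus.dSt K γ₀ c₀ δ₀ * ρ y y'))) ∧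
    (∀ β : Λ → ℝ, (∀ y, 0 ≤ β y) → (∀ (y : Λ) (z : Y), z ∉ Λ → β y ≤ ρ y z) →
      ∀ y y' : Λ, |cLam H ak Qk a ℓ w Q Λ y y' - (deltaK H ak Qk + (a * ℓ) • pOp w Q)⁻¹ y y'| ≤
        B4Sect5Torus.cSt K γ₀ c₀ δ₀ *
          Real.exp (-(B4Sect5Torus.dSt K γ₀ c₀ δ₀ * (ρ y y' + β y + β y')))) ∧
    (∀ (H₀ : Matrix X X ℝ) (ω : Y → ℝ),
      B4Sect5Torus.Hyp56 ρ (deltaK H₀ ak Qk + (a * ℓ) • pOp w Q) γ₀ c₀ δ₀ → (∀ y, 0 ≤ ω y) →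
      (∀ y z, ω y ≤ ρ y z + ω z) → B4Sect5Torus.Hyp59 ρ ω (deltaK H₀ ak Qk - deltaK H ak Qk) c₀ δ₀ →
      ∀ y y' : Λ, |cLam H ak Qk a ℓ w Q Λ y y' - cLam H₀ ak Qk a ℓ w Q Λ y y'| ≤
        B4Sect5Torus.cSt K γ₀ c₀ δ₀ *
          Real.exp (-(B4Sect5Torus.dSt K γ₀ c₀ δ₀ * (ρ y y' + ω y + ω y')))) := by
  have main := B4Sect5Torus.sect5_uniform hK hγ hc hδ hρ hSB h56
    (e := (Subtype.val : Λ → Y)) Subtype.val_injective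
  obtain ⟨m1, m2, m3⟩ := main
  refine ⟨fun y y' => m1 y y', fun β hβ0 hβ y y' => ?_, fun H₀ ω h56₀ hω0 hω h59 y y' => ?_⟩
  · refine m2 β hβ0 (fun i z hz => hβ i z ?_) y y'
    intro hzΛ
    exact hz ⟨⟨z, hzΛ⟩, rfl⟩
  · set A := deltaK H ak Qk + (a * ℓ) • pOp w Q with hA
    set A₀ := deltaK H₀ ak Qk + (a * ℓ) • pOp w Q with hA₀
    have hAB : A + (A₀ - A) = A₀ := by abel
    have hB : A₀ - A = deltaK H₀ ak Qk - deltaK H ak Qk := by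
      rw [hA, hA₀]; exact add_sub_add_right_eq_sub _ _ _
    have h := m3 (A₀ - A) ω (by rw [hAB]; exact h56₀) hω0 hω (by rw [hB]; exact h59) y y'
    rw [hAB] at h
    exact h

/-! ## §5. (1.16), (1.18) for every `Λ` and every gauge field from (5.3) and Corollary 2.3 — explicit constants -/

/-- **(1.16) and (1.17)–(1.18) of Proposition I.2.3 for a general gauge field, every finite region and EVERY `Λ`**, by
the §5 route of pp. 593–594, from exactly the printed inputs: (5.3) (`hlow`, Proposition II.3.1′), Corollary 2.3
(2.30) for `G_k(Ω,A)` (`hG`), the structure of the block averagings (`hS`, `hT`, `hρS`, `hρP`, `hP1`), symmetry of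
the form matrix, and a lattice-sum profile `K` of the unit lattice (`hSB`).  Constants: `c₀ = (a_k²cκc_k + aL^{−2} +
a_k)e^{δr}`, `δ₀ = δ` in (5.6), then `c₁ = cSt K γ₀ c₀ δ`, `δ₁ = dSt K γ₀ c₀ δ` of `B4Sect5Torus` — *"The constants
δ₁, c₁ are functions of δ₀, γ₀, c₀"* (p. 597). [cite: Balaban1983RegularityDecay, Prop. 2.3 of [1] (1.16)–(1.18) p.574, (5.3)–(5.4) p.593, Sect. 5 Theorem p.594] -/
theorem prop23_116_118_of_cor23 [Fintype X] [Fintype Y] [Fintype Z] [DecidableEq X] [DecidableEq Y]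
    {K : ℝ → ℝ} (hK : ∀ t, 0 < t → 0 ≤ K t) {γ₀ : ℝ} (hγ : 0 < γ₀)
    {ρ : Y → Y → ℝ} (hρ : B4Sect5Torus.IsPseudoDist ρ) (hSB : B4Sect5Torus.SumBound ρ K)
    {H : Matrix X X ℝ} {ak : ℝ} {Qk : Matrix Y X ℝ} {a ℓ w : ℝ} {Q : Matrix Z Y ℝ}
    {nrm : (X → ℝ) → ℝ} {sdist : Finset X → Finset X → ℝ} {κ ck c δ r : ℝ} (S : Y → Finset X)
    (hH : H.IsSymm)
    (hlow : ∀ v : Y → ℝ, γ₀ * (v ⬝ᵥ v) ≤ v ⬝ᵥ ((deltaK H ak Qk + (a * ℓ) • pOp w Q) *ᵥ v))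
    (hS : ∀ (y : Y) (x : X), x ∉ S y → Qk y x = 0)
    (hT : ∀ y : Y, (fun x => Qk y x) ⬝ᵥ (fun x => Qk y x) ≤ ck)
    (hn2 : ∀ u, nrm u ^ 2 = κ * (u ⬝ᵥ u)) (hκ : 0 ≤ κ) (hc : 0 ≤ c) (hck : 0 ≤ ck) (hak : 0 < ak)
    (haℓ : 0 ≤ a * ℓ)
    (hG : ∀ (g g' : X → ℝ) (U U' : Finset X), (∀ x ∉ U, g x = 0) → (∀ x ∉ U', g' x = 0) →
      |g ⬝ᵥ (gk H ak Qk *ᵥ g')| ≤ c * nrm g * nrm g' * Real.exp (-(δ * sdist U U')))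
    (hδ : 0 < δ) (hr : 0 ≤ r) (hρS : ∀ y y', ρ y y' ≤ sdist (S y) (S y') + r)
    (hρP : ∀ y y', pOp w Q y y' ≠ 0 → ρ y y' ≤ r) (hP1 : ∀ y y', |pOp w Q y y'| ≤ 1) (Λ : Finset Y) :
    (∀ y y' : Λ, |cLam H ak Qk a ℓ w Q Λ y y'| ≤
        B4Sect5Torus.cSt K γ₀ ((ak ^ 2 * (c * (κ * ck)) + a * ℓ + ak) * Real.exp (δ * r)) δ *
          Real.exp (-(B4Sect5Torus.dSt K γ₀ ((ak ^ 2 * (c * (κ * ck)) + a * ℓ + ak) * Real.exp (δ * r)) δ *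
            ρ y y'))) ∧
    (∀ β : Λ → ℝ, (∀ y, 0 ≤ β y) → (∀ (y : Λ) (z : Y), z ∉ Λ → β y ≤ ρ y z) →
      ∀ y y' : Λ, |cLam H ak Qk a ℓ w Q Λ y y' - (deltaK H ak Qk + (a * ℓ) • pOp w Q)⁻¹ y y'| ≤
        B4Sect5Torus.cSt K γ₀ ((ak ^ 2 * (c * (κ * ck)) + a * ℓ + ak) * Real.exp (δ * r)) δ *
          Real.exp (-(B4Sect5Torus.dSt K γ₀ ((ak ^ 2 * (c * (κ * ck)) + a * ℓ + ak) * Real.exp (δ * r)) δ *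
            (ρ y y' + β y + β y')))) := by
  have hc₀ : 0 < (ak ^ 2 * (c * (κ * ck)) + a * ℓ + ak) * Real.exp (δ * r) := by
    have : 0 ≤ ak ^ 2 * (c * (κ * ck)) := mul_nonneg (sq_nonneg _) (mul_nonneg hc (mul_nonneg hκ hck))
    exact mul_pos (by linarith) (Real.exp_pos _)
  have hdec := abs_kOp_apply_le_exp S hS hT hn2 hκ hc hck hak.le haℓ hG hδ.le hρS hρP
    (fun y => by rw [hρ.zero]; exact hr) hP1 (H := H) (w := w) (Q := Q)
  have h56 := hyp56_kOp hH hlow hdec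
  have h := prop23_of_sect5 hK hγ hc₀ hδ hρ hSB h56 Λ
  exact ⟨h.1, h.2.1⟩

/-! ## §6. (v1.1) The two printed routes combined: (1.16), (1.18) for every `Λ` from Corollary 2.3-type bounds only -/

/-- **(1.16) and (1.17)–(1.18) for a general gauge field and EVERY `Λ ⊆ Ω^{(k)}`, modulo Corollary 2.3-type inputs for
the one-scale propagators only**: the §5 route (`prop23_116_118_of_cor23`) with its lower bound (5.3) taken from the
§3 route instead of Proposition II.3.1′ — p. 589: *"so the inequalities (1.15), (1.16), (1.20) are simple consequences
of Corollary 2.3"*, here (1.15) at `Λ = Ω^{(k)}`: the representation (3.6) for `C^{(k)}(Ω,A)` (`h36U`, PROVED for block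
averagings: `B4GaussRep36Proof.rep36`, `B4Sect3BlockAveraging.rep36_avgOp`), positivity (1.8) of the form (3.5)
(`hKU`), the `L²` bound `⟨g, G^η_{k+1}(Ω,A)g⟩ ≤ c′‖g‖²` (`hG0`, Corollary 2.3 (2.32)-type, the printed input), the
row-Gram bound of the functions of (3.8) (`hTT`, PROVED for block averagings: `B4Sect3BlockAveraging.tOp_gram_form_le`)
and `0 ≤ P(A) ≤ 1` (`hPnn`, `hPle`; `B4Sect3BlockAveraging.dotProduct_pOp_mulVec_nonneg/_le`) give
`γ₀ = (c′c_k′ + a_k⁻¹)⁻¹` (`B4Ineq115Sect3Route.form115_lower`); then Corollary 2.3 (2.30) for `G_k(Ω,A)` (`hG`) gives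
(5.4), and the kernel-proved Sect. 5 Theorem gives (1.16), (1.18) with `c₁ = cSt K γ₀ c₀ δ`, `δ₁ = dSt K γ₀ c₀ δ`,
`c₀ = (a_k²cκc_k + aL^{−2} + a_k)e^{δr}`.  OUR ASSEMBLY of two printed arguments; the statement proved is the printed
(1.16)/(1.18). [cite: Balaban1983RegularityDecay, Prop. 2.3 of [1] (1.15)–(1.18) p.574, p.589, (5.4) p.593, Sect. 5 Theorem p.594] -/
theorem prop23_116_118_of_cor23_rep36 [Fintype X] [Fintype Y] [Fintype Z] [DecidableEq X] [DecidableEq Y]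
    [DecidableEq Z] {K : ℝ → ℝ} (hK : ∀ t, 0 < t → 0 ≤ K t)
    {ρ : Y → Y → ℝ} (hρ : B4Sect5Torus.IsPseudoDist ρ) (hSB : B4Sect5Torus.SumBound ρ K)
    {H : Matrix X X ℝ} {ak : ℝ} {Qk : Matrix Y X ℝ} {a ℓ w : ℝ} {Q : Matrix Z Y ℝ}
    {nrm : (X → ℝ) → ℝ} {sdist : Finset X → Finset X → ℝ} {κ ck ck' c c' δ r : ℝ} (S : Y → Finset X)
    (hH : H.IsSymm)
    (h36U : cLam H ak Qk a ℓ w Q Finset.univ = rep36Rhs H ak Qk a ℓ w Q Finset.univ Finset.univ)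
    (hKU : (kLam H ak Qk a ℓ w Q Finset.univ Finset.univ).PosDef)
    (hG0 : ∀ g : X → ℝ, g ⬝ᵥ (gNext H ak Qk a ℓ w Q *ᵥ g) ≤ c' * (g ⬝ᵥ g)) (hc' : 0 ≤ c')
    (hTT : ∀ u : ↥(Finset.univ : Finset Y) → ℝ,
      u ⬝ᵥ ((tOp ak Qk a ℓ w Q Finset.univ Finset.univ * (tOp ak Qk a ℓ w Q Finset.univ Finset.univ)ᵀ) *ᵥ u)
        ≤ ck' * (u ⬝ᵥ u))
    (hck' : 0 ≤ ck') (hPnn : ∀ v : Y → ℝ, 0 ≤ v ⬝ᵥ (pOp w Q *ᵥ v))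
    (hPle : ∀ v : Y → ℝ, v ⬝ᵥ (pOp w Q *ᵥ v) ≤ v ⬝ᵥ v)
    (hS : ∀ (y : Y) (x : X), x ∉ S y → Qk y x = 0)
    (hT : ∀ y : Y, (fun x => Qk y x) ⬝ᵥ (fun x => Qk y x) ≤ ck)
    (hn2 : ∀ u, nrm u ^ 2 = κ * (u ⬝ᵥ u)) (hκ : 0 ≤ κ) (hc : 0 ≤ c) (hck : 0 ≤ ck) (hak : 0 < ak)
    (ha : 0 ≤ a) (hℓ : 0 ≤ ℓ)
    (hG : ∀ (g g' : X → ℝ) (U U' : Finset X), (∀ x ∉ U, g x = 0) → (∀ x ∉ U', g' x = 0) →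
      |g ⬝ᵥ (gk H ak Qk *ᵥ g')| ≤ c * nrm g * nrm g' * Real.exp (-(δ * sdist U U')))
    (hδ : 0 < δ) (hr : 0 ≤ r) (hρS : ∀ y y', ρ y y' ≤ sdist (S y) (S y') + r)
    (hρP : ∀ y y', pOp w Q y y' ≠ 0 → ρ y y' ≤ r) (hP1 : ∀ y y', |pOp w Q y y'| ≤ 1) (Λ : Finset Y) :
    (∀ y y' : Λ, |cLam H ak Qk a ℓ w Q Λ y y'| ≤
        B4Sect5Torus.cSt K (c' * ck' + 1 / ak)⁻¹ ((ak ^ 2 * (c * (κ * ck)) + a * ℓ + ak) * Real.exp (δ * r)) δ *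
          Real.exp (-(B4Sect5Torus.dSt K (c' * ck' + 1 / ak)⁻¹
            ((ak ^ 2 * (c * (κ * ck)) + a * ℓ + ak) * Real.exp (δ * r)) δ * ρ y y'))) ∧
    (∀ β : Λ → ℝ, (∀ y, 0 ≤ β y) → (∀ (y : Λ) (z : Y), z ∉ Λ → β y ≤ ρ y z) →
      ∀ y y' : Λ, |cLam H ak Qk a ℓ w Q Λ y y' - (deltaK H ak Qk + (a * ℓ) • pOp w Q)⁻¹ y y'| ≤
        B4Sect5Torus.cSt K (c' * ck' + 1 / ak)⁻¹ ((ak ^ 2 * (c * (κ * ck)) + a * ℓ + ak) * Real.exp (δ * r)) δ *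
          Real.exp (-(B4Sect5Torus.dSt K (c' * ck' + 1 / ak)⁻¹
            ((ak ^ 2 * (c * (κ * ck)) + a * ℓ + ak) * Real.exp (δ * r)) δ * (ρ y y' + β y + β y')))) := by
  have hlow : ∀ v : Y → ℝ, (c' * ck' + 1 / ak)⁻¹ * (v ⬝ᵥ v) ≤
      v ⬝ᵥ ((deltaK H ak Qk + (a * ℓ) • pOp w Q) *ᵥ v) :=
    fun v => B4Ineq115Sect3Route.form115_lower h36U hKU hG0 hc' hTT hck' hPnn hPle hak ha hℓ v
  have hγ : 0 < (c' * ck' + 1 / ak)⁻¹ := by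
    have : 0 ≤ c' * ck' := mul_nonneg hc' hck'
    have : 0 < 1 / ak := one_div_pos.mpr hak
    exact inv_pos.mpr (by linarith)
  exact prop23_116_118_of_cor23 hK hγ hρ hSB S hH hlow hS hT hn2 hκ hc hck hak (mul_nonneg ha hℓ) hG hδ hr
    hρS hρP hP1 Λ

/-! ## §7. (v1.2) (1.19)–(1.20) for every `Λ` and every gauge field from (5.3), Corollary 2.3 and the Theorem (1.11)–(1.12) — explicit constants -/

/-- **(1.19)–(1.20) of Proposition I.2.3 for a general gauge field, two finite regions `Ω ⊂ Ω₀` and EVERY `Λ`**, by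
the §5 route of pp. 593–594, from exactly the printed inputs: (5.3) for the operators of `Ω` and of `Ω₀` (`hlow`,
`hlow₀`, Proposition II.3.1′), Corollary 2.3 (2.30) for `G_k(Ω,A)` and `G_k(Ω₀,A)` (`hG`, `hG₀` ⇒ (5.4) for both,
`abs_kOp_apply_le_exp`), the Theorem (1.11)–(1.12) for `δG_k(Ω,Ω₀,A) = G_k(Ω,A) − G_k(Ω₀,A)` (`hGd` ⇒ (5.5),
`abs_deltaK_sub_apply_le_exp`; `sdc U` = the distance of `U` to the complement region `Ω^c`), the structure of the
block averagings (`hS`, `hT`, `hρS`, `hρP`, `hP1`), symmetry of the form matrices, a lattice-sum profile `K` of the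
unit lattice (`hSB`) and an admissible boundary weight `ω` (`0 ≤ ω`, `ρ`-Lipschitz, `ω(y) ≤ sdc S_y + r`; for the
lattice: `ω = dist(·,Ω^{(k)c})`):  *"for Λ ⊂ Ω^{(k)} ⊂ Ω₀^{(k)} and δC^{(k)}_Λ(Ω,Ω₀,A) = C^{(k)}_Λ(Ω,A) − C^{(k)}_Λ(Ω₀,A)
we have |δC^{(k)}_Λ(Ω,Ω₀,A;x,x′)| ≤ c₀exp(−δ₀|x−x′| − δ₀dist(x,Ω^{(k)c}) − δ₀dist(x′,Ω^{(k)c}))"* with `c₁ = cSt K γ₀ c₀ δ`,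
`δ₁ = dSt K γ₀ c₀ δ` of `B4Sect5Torus` at the single constant `c₀ = (a_k²cκc_k + aL^{−2} + a_k)e^{3δr}` (which
dominates the (5.4)-constant `(…)e^{δr}` of both operators and the (5.5)-constant `a_k²cκc_k·e^{3δr}`), `δ₀ = δ` — the
third conclusion of `prop23_of_sect5` ((5.10) of the Sect. 5 Theorem) with (5.6) for both operators (`hyp56_kOp`) and
(5.9) for the difference (`hyp59_deltaK_sub`).  The two regions enter through two form matrices `H` (of `Ω`; inside
`Ω₀` e.g. Neumann-decoupled along `∂Ω`) and `H₀` (of `Ω₀`) on the same index sets, as in §2.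
[cite: Balaban1983RegularityDecay, Prop. 2.3 of [1] (1.19)–(1.20) p.574, (5.3)–(5.5) pp.593–594, Sect. 5 Theorem (5.9)–(5.10) p.594] -/
theorem prop23_120_of_cor23 [Fintype X] [Fintype Y] [Fintype Z] [DecidableEq X] [DecidableEq Y]
    {K : ℝ → ℝ} (hK : ∀ t, 0 < t → 0 ≤ K t) {γ₀ : ℝ} (hγ : 0 < γ₀)
    {ρ : Y → Y → ℝ} (hρ : B4Sect5Torus.IsPseudoDist ρ) (hSB : B4Sect5Torus.SumBound ρ K)
    {H H₀ : Matrix X X ℝ} {ak : ℝ} {Qk : Matrix Y X ℝ} {a ℓ w : ℝ} {Q : Matrix Z Y ℝ}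
    {nrm : (X → ℝ) → ℝ} {sdist : Finset X → Finset X → ℝ} {sdc : Finset X → ℝ} {κ ck c δ r : ℝ}
    (S : Y → Finset X) (hH : H.IsSymm) (hH₀ : H₀.IsSymm)
    (hlow : ∀ v : Y → ℝ, γ₀ * (v ⬝ᵥ v) ≤ v ⬝ᵥ ((deltaK H ak Qk + (a * ℓ) • pOp w Q) *ᵥ v))
    (hlow₀ : ∀ v : Y → ℝ, γ₀ * (v ⬝ᵥ v) ≤ v ⬝ᵥ ((deltaK H₀ ak Qk + (a * ℓ) • pOp w Q) *ᵥ v))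
    (hS : ∀ (y : Y) (x : X), x ∉ S y → Qk y x = 0)
    (hT : ∀ y : Y, (fun x => Qk y x) ⬝ᵥ (fun x => Qk y x) ≤ ck)
    (hn2 : ∀ u, nrm u ^ 2 = κ * (u ⬝ᵥ u)) (hκ : 0 ≤ κ) (hc : 0 ≤ c) (hck : 0 ≤ ck) (hak : 0 < ak)
    (haℓ : 0 ≤ a * ℓ)
    (hG : ∀ (g g' : X → ℝ) (U U' : Finset X), (∀ x ∉ U, g x = 0) → (∀ x ∉ U', g' x = 0) →
      |g ⬝ᵥ (gk H ak Qk *ᵥ g')| ≤ c * nrm g * nrm g' * Real.exp (-(δ * sdist U U')))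
    (hG₀ : ∀ (g g' : X → ℝ) (U U' : Finset X), (∀ x ∉ U, g x = 0) → (∀ x ∉ U', g' x = 0) →
      |g ⬝ᵥ (gk H₀ ak Qk *ᵥ g')| ≤ c * nrm g * nrm g' * Real.exp (-(δ * sdist U U')))
    (hGd : ∀ (g g' : X → ℝ) (U U' : Finset X), (∀ x ∉ U, g x = 0) → (∀ x ∉ U', g' x = 0) →
      |g ⬝ᵥ ((gk H ak Qk - gk H₀ ak Qk) *ᵥ g')| ≤
        c * nrm g * nrm g' * Real.exp (-(δ * (sdist U U' + sdc U + sdc U'))))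
    (hδ : 0 < δ) (hr : 0 ≤ r) (hρS : ∀ y y', ρ y y' ≤ sdist (S y) (S y') + r)
    (hρP : ∀ y y', pOp w Q y y' ≠ 0 → ρ y y' ≤ r) (hP1 : ∀ y y', |pOp w Q y y'| ≤ 1)
    {ω : Y → ℝ} (hω0 : ∀ y, 0 ≤ ω y) (hωρ : ∀ y z, ω y ≤ ρ y z + ω z) (hωS : ∀ y, ω y ≤ sdc (S y) + r)
    (Λ : Finset Y) (y y' : Λ) :
    |cLam H ak Qk a ℓ w Q Λ y y' - cLam H₀ ak Qk a ℓ w Q Λ y y'| ≤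
      B4Sect5Torus.cSt K γ₀ ((ak ^ 2 * (c * (κ * ck)) + a * ℓ + ak) * Real.exp (3 * (δ * r))) δ *
        Real.exp (-(B4Sect5Torus.dSt K γ₀ ((ak ^ 2 * (c * (κ * ck)) + a * ℓ + ak) * Real.exp (3 * (δ * r))) δ *
          (ρ y y' + ω y + ω y'))) := by
  set C : ℝ := (ak ^ 2 * (c * (κ * ck)) + a * ℓ + ak) * Real.exp (3 * (δ * r)) with hC
  have hA0 : 0 ≤ ak ^ 2 * (c * (κ * ck)) := mul_nonneg (sq_nonneg _) (mul_nonneg hc (mul_nonneg hκ hck))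
  have hC₀ : 0 < C := mul_pos (by linarith) (Real.exp_pos _)
  have hδr : 0 ≤ δ * r := mul_nonneg hδ.le hr
  have hup : (ak ^ 2 * (c * (κ * ck)) + a * ℓ + ak) * Real.exp (δ * r) ≤ C :=
    mul_le_mul_of_nonneg_left (Real.exp_le_exp.mpr (by linarith)) (by linarith)
  have hup' : ak ^ 2 * (c * (κ * ck)) * Real.exp (3 * (δ * r)) ≤ C :=
    mul_le_mul_of_nonneg_right (by linarith) (Real.exp_pos _).le
  have hρ0 : ∀ y : Y, ρ y y ≤ r := fun y => by rw [hρ.zero]; exact hr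
  have hdec : ∀ y y', |(deltaK H ak Qk + (a * ℓ) • pOp w Q) y y'| ≤ C * Real.exp (-(δ * ρ y y')) :=
    fun y y' => (abs_kOp_apply_le_exp S hS hT hn2 hκ hc hck hak.le haℓ hG hδ.le hρS hρP hρ0 hP1 y y').trans
      (mul_le_mul_of_nonneg_right hup (Real.exp_pos _).le)
  have hdec₀ : ∀ y y', |(deltaK H₀ ak Qk + (a * ℓ) • pOp w Q) y y'| ≤ C * Real.exp (-(δ * ρ y y')) :=
    fun y y' => (abs_kOp_apply_le_exp S hS hT hn2 hκ hc hck hak.le haℓ hG₀ hδ.le hρS hρP hρ0 hP1 y y').trans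
      (mul_le_mul_of_nonneg_right hup (Real.exp_pos _).le)
  have h55 : ∀ y y', |(deltaK H ak Qk - deltaK H₀ ak Qk) y y'| ≤
      C * Real.exp (-(δ * (ρ y y' + ω y + ω y'))) :=
    fun y y' => (abs_deltaK_sub_apply_le_exp S hS hT hn2 hκ hc hck hGd hδ.le hρS hωS y y').trans
      (mul_le_mul_of_nonneg_right hup' (Real.exp_pos _).le)
  have h56 := hyp56_kOp hH hlow hdec
  have h56₀ := hyp56_kOp hH₀ hlow₀ hdec₀
  have h59 := hyp59_deltaK_sub h55
  exact (prop23_of_sect5 hK hγ hC₀ hδ hρ hSB h56 Λ).2.2 H₀ ω h56₀ hω0 hωρ h59 y y'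

/-- **(1.19)–(1.20) for a general gauge field and EVERY `Λ ⊆ Ω^{(k)}`, modulo Corollary 2.3-type inputs for the
one-scale propagators and the Theorem (1.11)–(1.12) for their difference** — `prop23_120_of_cor23` with the lower
bounds (5.3) for BOTH operators taken from the §3 route's (1.15), exactly as in §6 (p. 589: *"so the inequalities
(1.15), (1.16), (1.20) are simple consequences of Corollary 2.3"*): (3.6) at `Λ = Ω^{(k)}` (`h36U`, `h36U₀`),
positivity (1.8) of the forms (3.5) (`hKU`, `hKU₀`), the `L²` bounds of the two-scale propagators built on `H`, `H₀`
(`hG0`, `hG0₀`, common constant `c′`), the row-Gram bound of the functions of (3.8) (`hTT`, independent of the form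
matrix) and `0 ≤ P(A) ≤ 1` give `γ₀ = (c′c_k′ + a_k⁻¹)⁻¹` for both (`B4Ineq115Sect3Route.form115_lower`); the rest as
in `prop23_120_of_cor23`.  OUR ASSEMBLY of the two printed arguments; the statement proved is the printed (1.20).
[cite: Balaban1983RegularityDecay, Prop. 2.3 of [1] (1.15), (1.19)–(1.20) p.574, p.589, (5.4)–(5.5) pp.593–594, Sect. 5 Theorem p.594] -/
theorem prop23_120_of_cor23_rep36 [Fintype X] [Fintype Y] [Fintype Z] [DecidableEq X] [DecidableEq Y]
    [DecidableEq Z] {K : ℝ → ℝ} (hK : ∀ t, 0 < t → 0 ≤ K t)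
    {ρ : Y → Y → ℝ} (hρ : B4Sect5Torus.IsPseudoDist ρ) (hSB : B4Sect5Torus.SumBound ρ K)
    {H H₀ : Matrix X X ℝ} {ak : ℝ} {Qk : Matrix Y X ℝ} {a ℓ w : ℝ} {Q : Matrix Z Y ℝ}
    {nrm : (X → ℝ) → ℝ} {sdist : Finset X → Finset X → ℝ} {sdc : Finset X → ℝ} {κ ck ck' c c' δ r : ℝ}
    (S : Y → Finset X) (hH : H.IsSymm) (hH₀ : H₀.IsSymm)
    (h36U : cLam H ak Qk a ℓ w Q Finset.univ = rep36Rhs H ak Qk a ℓ w Q Finset.univ Finset.univ)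
    (h36U₀ : cLam H₀ ak Qk a ℓ w Q Finset.univ = rep36Rhs H₀ ak Qk a ℓ w Q Finset.univ Finset.univ)
    (hKU : (kLam H ak Qk a ℓ w Q Finset.univ Finset.univ).PosDef)
    (hKU₀ : (kLam H₀ ak Qk a ℓ w Q Finset.univ Finset.univ).PosDef)
    (hG0 : ∀ g : X → ℝ, g ⬝ᵥ (gNext H ak Qk a ℓ w Q *ᵥ g) ≤ c' * (g ⬝ᵥ g))
    (hG0₀ : ∀ g : X → ℝ, g ⬝ᵥ (gNext H₀ ak Qk a ℓ w Q *ᵥ g) ≤ c' * (g ⬝ᵥ g)) (hc' : 0 ≤ c')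
    (hTT : ∀ u : ↥(Finset.univ : Finset Y) → ℝ,
      u ⬝ᵥ ((tOp ak Qk a ℓ w Q Finset.univ Finset.univ * (tOp ak Qk a ℓ w Q Finset.univ Finset.univ)ᵀ) *ᵥ u)
        ≤ ck' * (u ⬝ᵥ u))
    (hck' : 0 ≤ ck') (hPnn : ∀ v : Y → ℝ, 0 ≤ v ⬝ᵥ (pOp w Q *ᵥ v))
    (hPle : ∀ v : Y → ℝ, v ⬝ᵥ (pOp w Q *ᵥ v) ≤ v ⬝ᵥ v)
    (hS : ∀ (y : Y) (x : X), x ∉ S y → Qk y x = 0)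
    (hT : ∀ y : Y, (fun x => Qk y x) ⬝ᵥ (fun x => Qk y x) ≤ ck)
    (hn2 : ∀ u, nrm u ^ 2 = κ * (u ⬝ᵥ u)) (hκ : 0 ≤ κ) (hc : 0 ≤ c) (hck : 0 ≤ ck) (hak : 0 < ak)
    (ha : 0 ≤ a) (hℓ : 0 ≤ ℓ)
    (hG : ∀ (g g' : X → ℝ) (U U' : Finset X), (∀ x ∉ U, g x = 0) → (∀ x ∉ U', g' x = 0) →
      |g ⬝ᵥ (gk H ak Qk *ᵥ g')| ≤ c * nrm g * nrm g' * Real.exp (-(δ * sdist U U')))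
    (hG₀ : ∀ (g g' : X → ℝ) (U U' : Finset X), (∀ x ∉ U, g x = 0) → (∀ x ∉ U', g' x = 0) →
      |g ⬝ᵥ (gk H₀ ak Qk *ᵥ g')| ≤ c * nrm g * nrm g' * Real.exp (-(δ * sdist U U')))
    (hGd : ∀ (g g' : X → ℝ) (U U' : Finset X), (∀ x ∉ U, g x = 0) → (∀ x ∉ U', g' x = 0) →
      |g ⬝ᵥ ((gk H ak Qk - gk H₀ ak Qk) *ᵥ g')| ≤
        c * nrm g * nrm g' * Real.exp (-(δ * (sdist U U' + sdc U + sdc U'))))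
    (hδ : 0 < δ) (hr : 0 ≤ r) (hρS : ∀ y y', ρ y y' ≤ sdist (S y) (S y') + r)
    (hρP : ∀ y y', pOp w Q y y' ≠ 0 → ρ y y' ≤ r) (hP1 : ∀ y y', |pOp w Q y y'| ≤ 1)
    {ω : Y → ℝ} (hω0 : ∀ y, 0 ≤ ω y) (hωρ : ∀ y z, ω y ≤ ρ y z + ω z) (hωS : ∀ y, ω y ≤ sdc (S y) + r)
    (Λ : Finset Y) (y y' : Λ) :
    |cLam H ak Qk a ℓ w Q Λ y y' - cLam H₀ ak Qk a ℓ w Q Λ y y'| ≤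
      B4Sect5Torus.cSt K (c' * ck' + 1 / ak)⁻¹
          ((ak ^ 2 * (c * (κ * ck)) + a * ℓ + ak) * Real.exp (3 * (δ * r))) δ *
        Real.exp (-(B4Sect5Torus.dSt K (c' * ck' + 1 / ak)⁻¹
          ((ak ^ 2 * (c * (κ * ck)) + a * ℓ + ak) * Real.exp (3 * (δ * r))) δ * (ρ y y' + ω y + ω y'))) := by
  have hlow : ∀ v : Y → ℝ, (c' * ck' + 1 / ak)⁻¹ * (v ⬝ᵥ v) ≤
      v ⬝ᵥ ((deltaK H ak Qk + (a * ℓ) • pOp w Q) *ᵥ v) :=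
    fun v => B4Ineq115Sect3Route.form115_lower h36U hKU hG0 hc' hTT hck' hPnn hPle hak ha hℓ v
  have hlow₀ : ∀ v : Y → ℝ, (c' * ck' + 1 / ak)⁻¹ * (v ⬝ᵥ v) ≤
      v ⬝ᵥ ((deltaK H₀ ak Qk + (a * ℓ) • pOp w Q) *ᵥ v) :=
    fun v => B4Ineq115Sect3Route.form115_lower h36U₀ hKU₀ hG0₀ hc' hTT hck' hPnn hPle hak ha hℓ v
  have hγ : 0 < (c' * ck' + 1 / ak)⁻¹ := by
    have : 0 ≤ c' * ck' := mul_nonneg hc' hck'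
    have : 0 < 1 / ak := one_div_pos.mpr hak
    exact inv_pos.mpr (by linarith)
  exact prop23_120_of_cor23 hK hγ hρ hSB S hH hH₀ hlow hlow₀ hS hT hn2 hκ hc hck hak (mul_nonneg ha hℓ) hG hG₀
    hGd hδ hr hρS hρP hP1 hω0 hωρ hωS Λ y y'

end Literature.MathematicalPhysics.QuantumFieldTheory.Balaban1983to89.B4Prop23Sect5Route
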